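import Summits.CriticalPhenomena.CardyFormulaZ2.Theorems.CardySusyWardParafermionFamiliesToSLESixFluxPropagationGeometry

/-!
# Flux propagation (stub S6, crux stmt-CriticalPhenomena-10814), II: grid cells, side pairs, counting

Helper file 2/4 for `stub_fluxPropagationI`: the integer bookkeeping of the axis-parallel grid of cells
(doubled modulus `m`): a vertex of a low cell not adjacent to two grid lines has its twins outside the low
cells along a SIDE PAIR or not at all (`fiveWay_of_regular`); the EXACT decomposition of the side-pair flux
functionals into vertex sum + half-CR form + staggered combination (`norm_partialFlux_le`); the harmonic sum
`Σ_{i≤m} i^{-1/3} ≤ (3/2) m^{2/3}` (registered one-line form `stub_flux_harmonicSum`); counting of medial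
vertices through their doubled coordinates; the finite set `S′` (`Sset`) of the contour argument. [folklore]
-/

noncomputable section

namespace Summit.CriticalPhenomena.CardyFormulaZ2.Theorems.ParafermionFamiliesToSLESix.StripAnchored

open MeasureTheory Filter Set Metric Complex
open scoped Topology BigOperators ComplexConjugate
open Literature.Probability.LatticeModels
open Literature.Probability.RandomPlanarGeometry (DobrushinDomain)
open Literature.Barriers.CriticalPhenomena (medialCornersAt medialVertexOf)
open Literature.Barriers.CriticalPhenomena.HalfCRGreen (coeff twin coeff_zero coeff_one coeff_two coeff_three)

namespace S6

/-! ## Integer bookkeeping of the grid of cells -/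

/-- `(U+1)/m = U/m` away from the upper residue. [folklore] -/
theorem ediv_add_one_eq {m U : ℤ} (hm : 0 < m) (h : U % m + 1 < m) : (U + 1) / m = U / m := by
  have h1 := Int.emod_add_mul_ediv U m
  have h2 := Int.emod_nonneg U hm.ne'
  exact ((Int.ediv_emod_unique hm).2 ⟨by linarith, by linarith, h⟩).1

/-- `(U+1)/m = U/m + 1` at the upper residue. [folklore] -/
theorem ediv_add_one_eq_succ {m U : ℤ} (hm : 0 < m) (h : U % m = m - 1) : (U + 1) / m = U / m + 1 := by
  have h1 := Int.emod_add_mul_ediv U m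
  rw [h] at h1
  exact ((Int.ediv_emod_unique (r := 0) hm).2 ⟨by linarith, le_refl _, hm⟩).1

/-- `(U-1)/m = U/m` away from the residue `0`. [folklore] -/
theorem ediv_sub_one_eq {m U : ℤ} (hm : 0 < m) (h : 0 < U % m) : (U - 1) / m = U / m := by
  have h1 := Int.emod_add_mul_ediv U m
  have h2 := Int.emod_lt_of_pos U hm
  exact ((Int.ediv_emod_unique (r := U % m - 1) hm).2 ⟨by linarith, by linarith, by linarith⟩).1

/-- `(U-1)/m = U/m - 1` at the residue `0`. [folklore] -/
theorem ediv_sub_one_eq_pred {m U : ℤ} (hm : 0 < m) (h : U % m = 0) : (U - 1) / m = U / m - 1 := by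
  have h1 := Int.emod_add_mul_ediv U m
  rw [h] at h1
  exact ((Int.ediv_emod_unique (r := m - 1) hm).2 ⟨by linarith, by linarith, by linarith⟩).1

/-- Doubled abscissae of the four twins `NW, NE, SE, SW` of a vertex with doubled abscissa `U`. [folklore] -/
def shU (U : ℤ) : Fin 4 → ℤ := ![U - 1, U + 1, U + 1, U - 1]

/-- Doubled ordinates of the four twins `NW, NE, SE, SW` of a vertex with doubled ordinate `V`. [folklore] -/
def shV (V : ℤ) : Fin 4 → ℤ := ![V + 1, V + 1, V - 1, V - 1]

/-- Doubled abscissa of the twin. [folklore] -/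
theorem U_twin' (p : Site 2 × Fin 2) (k : Fin 4) : U (twin p.1 p.2 k) = shU (U p) k := by
  obtain ⟨x, i⟩ := p
  fin_cases i <;> fin_cases k <;> simp [twin, U, shU] <;> ring

/-- Doubled ordinate of the twin. [folklore] -/
theorem V_twin' (p : Site 2 × Fin 2) (k : Fin 4) : V (twin p.1 p.2 k) = shV (V p) k := by
  obtain ⟨x, i⟩ := p
  fin_cases i <;> fin_cases k <;> simp [twin, V, shV] <;> ring

/-- **Regular vertices of a union of grid cells have a side pair (or nothing) sticking out.** For a predicate `Low` on cells of the grid of doubled modulus `m ≥ 3`, a vertex of a low cell whose residues are not BOTH in `{0, m-1}` has its twins outside the low cells along one of `∅, {NW,NE}, {SE,SW}, {NE,SE}, {NW,SW}`; and along `∅` if no residue is in `{0, m-1}`. [folklore] -/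
theorem fiveWay_of_regular {m : ℤ} (hm : 3 ≤ m) (Low : ℤ → ℤ → Prop) {U V : ℤ} (hLow : Low (U / m) (V / m))
    (hreg : ¬ ((U % m = 0 ∨ U % m = m - 1) ∧ (V % m = 0 ∨ V % m = m - 1))) :
    (∃ K ∈ ({∅, {0, 1}, {2, 3}, {1, 2}, {0, 3}} : Finset (Finset (Fin 4))),
        ∀ k, ¬ Low (shU U k / m) (shV V k / m) ↔ k ∈ K) ∧
      (¬ (U % m = 0 ∨ U % m = m - 1) → ¬ (V % m = 0 ∨ V % m = m - 1) → ∀ k, Low (shU U k / m) (shV V k / m)) := by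
  have hm0 : 0 < m := by omega
  have hU0 := Int.emod_nonneg U hm0.ne'
  have hU1 := Int.emod_lt_of_pos U hm0
  have hV0 := Int.emod_nonneg V hm0.ne'
  have hV1 := Int.emod_lt_of_pos V hm0
  have hUreg : ¬ (U % m = 0 ∨ U % m = m - 1) → (U + 1) / m = U / m ∧ (U - 1) / m = U / m := fun hc =>
    ⟨ediv_add_one_eq hm0 (by omega), ediv_sub_one_eq hm0 (by omega)⟩
  have hVreg : ¬ (V % m = 0 ∨ V % m = m - 1) → (V + 1) / m = V / m ∧ (V - 1) / m = V / m := fun hc =>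
    ⟨ediv_add_one_eq hm0 (by omega), ediv_sub_one_eq hm0 (by omega)⟩
  by_cases cU : (U % m = 0 ∨ U % m = m - 1)
  · have cV : ¬ (V % m = 0 ∨ V % m = m - 1) := fun h => hreg ⟨cU, h⟩
    obtain ⟨v1, v2⟩ := hVreg cV
    refine ⟨?_, fun h => absurd cU h⟩
    rcases cU with c0 | c0
    · have u1 : (U + 1) / m = U / m := ediv_add_one_eq hm0 (by omega)
      have u2 : (U - 1) / m = U / m - 1 := ediv_sub_one_eq_pred hm0 c0
      by_cases hL : Low (U / m - 1) (V / m)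
      · exact ⟨∅, by decide, fun k => by fin_cases k <;> simp [shU, shV, u1, u2, v1, v2, hL, hLow]⟩
      · exact ⟨{0, 3}, by decide, fun k => by fin_cases k <;> simp [shU, shV, u1, u2, v1, v2, hL, hLow]⟩
    · have u1 : (U + 1) / m = U / m + 1 := ediv_add_one_eq_succ hm0 c0
      have u2 : (U - 1) / m = U / m := ediv_sub_one_eq hm0 (by omega)
      by_cases hL : Low (U / m + 1) (V / m)
      · exact ⟨∅, by decide, fun k => by fin_cases k <;> simp [shU, shV, u1, u2, v1, v2, hL, hLow]⟩
      · exact ⟨{1, 2}, by decide, fun k => by fin_cases k <;> simp [shU, shV, u1, u2, v1, v2, hL, hLow]⟩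
  · obtain ⟨u1, u2⟩ := hUreg cU
    by_cases cV : (V % m = 0 ∨ V % m = m - 1)
    · refine ⟨?_, fun _ h => absurd cV h⟩
      rcases cV with c0 | c0
      · have v1 : (V + 1) / m = V / m := ediv_add_one_eq hm0 (by omega)
        have v2 : (V - 1) / m = V / m - 1 := ediv_sub_one_eq_pred hm0 c0
        by_cases hL : Low (U / m) (V / m - 1)
        · exact ⟨∅, by decide, fun k => by fin_cases k <;> simp [shU, shV, u1, u2, v1, v2, hL, hLow]⟩
        · exact ⟨{2, 3}, by decide, fun k => by fin_cases k <;> simp [shU, shV, u1, u2, v1, v2, hL, hLow]⟩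
      · have v1 : (V + 1) / m = V / m + 1 := ediv_add_one_eq_succ hm0 c0
        have v2 : (V - 1) / m = V / m := ediv_sub_one_eq hm0 (by omega)
        by_cases hL : Low (U / m) (V / m + 1)
        · exact ⟨∅, by decide, fun k => by fin_cases k <;> simp [shU, shV, u1, u2, v1, v2, hL, hLow]⟩
        · exact ⟨{0, 1}, by decide, fun k => by fin_cases k <;> simp [shU, shV, u1, u2, v1, v2, hL, hLow]⟩
    · obtain ⟨v1, v2⟩ := hVreg cV
      have hall : ∀ k, Low (shU U k / m) (shV V k / m) := fun k => by
        fin_cases k <;> simp [shU, shV, u1, u2, v1, v2, hLow]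
      exact ⟨⟨∅, by decide, fun k => by simp [hall k]⟩, fun _ _ => hall⟩

/-! ## The exact decomposition of the side-pair functionals -/

/-- `‖(±1 ± i)/4‖ ≤ 1`. [folklore] -/
theorem norm_quarter_le (s t : ℂ) (hs : ‖s‖ = 1) (ht : ‖t‖ = 1) : ‖(s + t) / 4‖ ≤ 1 := by
  rw [norm_div, Complex.norm_ofNat]
  linarith [norm_add_le s t]

/-- **Side-pair functionals are good combinations.** For four values `g` satisfying the half-CR relation `g(NW) - g(SE) = i (g(NE) - g(SW))`, the flux functional `Σ coeff i k · g k` over one of the five admissible shapes `K` equals `a·Σg + ½·(relation) + c·(staggered)` with `|a|, |c| ≤ 1`, hence is bounded by `‖Σ_k g_k‖ + ‖g₀ - g₁ + g₂ - g₃‖`. [folklore] -/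
theorem norm_partialFlux_le (g : Fin 4 → ℂ) (hrel : g 0 - g 2 = I * (g 1 - g 3)) {K : Finset (Fin 4)}
    (hK : K ∈ ({∅, {0, 1}, {2, 3}, {1, 2}, {0, 3}} : Finset (Finset (Fin 4)))) :
    ‖∑ k ∈ K, coeff I k * g k‖ ≤ ‖∑ k : Fin 4, g k‖ + ‖g 0 - g 1 + g 2 - g 3‖ := by
  have n1 : ‖((1 : ℂ) + -I) / 4‖ ≤ 1 := norm_quarter_le 1 (-I) (by simp) (by simp)
  have n2 : ‖((1 : ℂ) + I) / 4‖ ≤ 1 := norm_quarter_le 1 I (by simp) (by simp)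
  have n3 : ‖((-1 : ℂ) + I) / 4‖ ≤ 1 := norm_quarter_le (-1) I (by simp) (by simp)
  have n4 : ‖((-1 : ℂ) + -I) / 4‖ ≤ 1 := norm_quarter_le (-1) (-I) (by simp) (by simp)
  set S := ∑ k : Fin 4, g k with hS
  set M := g 0 - g 1 + g 2 - g 3 with hM
  have hS4 : S = g 0 + g 1 + g 2 + g 3 := by rw [hS, Fin.sum_univ_four]
  have key : ∀ a c : ℂ, ‖a‖ ≤ 1 → ‖c‖ ≤ 1 → ‖a * S + c * M‖ ≤ ‖S‖ + ‖M‖ := fun a c ha hc =>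
    calc ‖a * S + c * M‖ ≤ ‖a * S‖ + ‖c * M‖ := norm_add_le _ _
      _ = ‖a‖ * ‖S‖ + ‖c‖ * ‖M‖ := by rw [norm_mul, norm_mul]
      _ ≤ 1 * ‖S‖ + 1 * ‖M‖ := by gcongr
      _ = ‖S‖ + ‖M‖ := by ring
  simp only [Finset.mem_insert, Finset.mem_singleton] at hK
  rcases hK with rfl | rfl | rfl | rfl | rfl
  · simp only [Finset.sum_empty, norm_zero]; positivity
  · rw [Finset.sum_pair (by decide), coeff_zero, coeff_one,
      show (1 : ℂ) * g 0 + -I * g 1 = (1 + -I) / 4 * S + (1 + I) / 4 * M by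
        rw [hS4, hM]; linear_combination (1 / 2 : ℂ) * hrel]
    exact key _ _ n1 n2
  · rw [Finset.sum_pair (by decide), coeff_two, coeff_three,
      show (-1 : ℂ) * g 2 + I * g 3 = (-1 + I) / 4 * S + (-1 + -I) / 4 * M by
        rw [hS4, hM]; linear_combination (1 / 2 : ℂ) * hrel]
    exact key _ _ n3 n4
  · rw [Finset.sum_pair (by decide), coeff_one, coeff_two,
      show -I * g 1 + (-1 : ℂ) * g 2 = (-1 + -I) / 4 * S + (-1 + I) / 4 * M by
        rw [hS4, hM]; linear_combination (1 / 2 : ℂ) * hrel]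
    exact key _ _ n4 n3
  · rw [Finset.sum_pair (by decide), coeff_zero, coeff_three,
      show (1 : ℂ) * g 0 + I * g 3 = (1 + I) / 4 * S + (1 + -I) / 4 * M by
        rw [hS4, hM]; linear_combination (1 / 2 : ℂ) * hrel]
    exact key _ _ n2 n1

/-- The flux coefficients at `χ = i` are unimodular. [folklore] -/
theorem norm_coeff_I (k : Fin 4) : ‖coeff I k‖ = 1 := by
  fin_cases k <;> simp [Literature.Barriers.CriticalPhenomena.HalfCRGreen.coeff]

/-! ## The harmonic sum `Σ i^{-1/3}` -/

/-- `Σ_{i=1}^{m} i^{-1/3} ≤ (3/2) m^{2/3}` (the integral test, in the elementary form `(b-a)²(b+2a) ≥ 0` for consecutive cube roots). [folklore] -/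
theorem sum_rpow_neg_third_le (m : ℕ) :
    ∑ i ∈ Finset.range m, ((i + 1 : ℕ) : ℝ) ^ (-(1:ℝ) / 3) ≤ 3 / 2 * (m : ℝ) ^ ((2:ℝ) / 3) := by
  have third : ∀ x : ℝ, 0 ≤ x → (x ^ ((1:ℝ) / 3)) ^ 3 = x := fun x hx => by
    rw [show ((1:ℝ) / 3) = ((3:ℕ) : ℝ)⁻¹ by norm_num]; exact Real.rpow_inv_natCast_pow hx (by norm_num)
  have twothird : ∀ x : ℝ, 0 ≤ x → x ^ ((2:ℝ) / 3) = (x ^ ((1:ℝ) / 3)) ^ 2 := fun x hx => by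
    rw [show ((2:ℝ) / 3) = (1:ℝ) / 3 * 2 by ring, Real.rpow_mul hx, Real.rpow_two]
  induction m with
  | zero => simp
  | succ m ih =>
    rw [Finset.sum_range_succ]
    have hm0 : (0:ℝ) ≤ m := Nat.cast_nonneg m
    have ha : 0 ≤ (m : ℝ) ^ ((1:ℝ) / 3) := Real.rpow_nonneg hm0 _
    have hb : 0 < ((m : ℝ) + 1) ^ ((1:ℝ) / 3) := Real.rpow_pos_of_pos (by linarith) _
    have ha3 := third _ hm0
    have hb3 : (((m : ℝ) + 1) ^ ((1:ℝ) / 3)) ^ 3 = m + 1 := third _ (by linarith)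
    rw [twothird _ hm0] at ih
    have hterm : ((m + 1 : ℕ) : ℝ) ^ (-(1:ℝ) / 3) = (((m : ℝ) + 1) ^ ((1:ℝ) / 3))⁻¹ := by
      push_cast; rw [show -(1:ℝ) / 3 = -((1:ℝ) / 3) by ring, Real.rpow_neg (by linarith)]
    have hgoal : ((m + 1 : ℕ) : ℝ) ^ ((2:ℝ) / 3) = (((m : ℝ) + 1) ^ ((1:ℝ) / 3)) ^ 2 := by
      push_cast; exact twothird _ (by linarith)
    rw [hterm, hgoal]
    have key : (((m : ℝ) + 1) ^ ((1:ℝ) / 3))⁻¹ ≤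
        3 / 2 * ((((m : ℝ) + 1) ^ ((1:ℝ) / 3)) ^ 2 - ((m : ℝ) ^ ((1:ℝ) / 3)) ^ 2) := by
      rw [inv_eq_one_div, div_le_iff₀ hb]
      nlinarith [mul_nonneg (sq_nonneg (((m : ℝ) + 1) ^ ((1:ℝ) / 3) - (m : ℝ) ^ ((1:ℝ) / 3)))
        (by positivity : (0:ℝ) ≤ ((m : ℝ) + 1) ^ ((1:ℝ) / 3) + 2 * (m : ℝ) ^ ((1:ℝ) / 3))]
    linarith

/-- The layer sum of the transversal estimate: `Σ_{j ≤ J} max(1,j)^{-1/3} ≤ 1 + (3/2) J^{2/3}`. [folklore] -/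
theorem sum_layers_le (J : ℕ) :
    ∑ j ∈ Finset.range (J + 1), ((max 1 j : ℕ) : ℝ) ^ (-(1:ℝ) / 3) ≤ 1 + 3 / 2 * (J : ℝ) ^ ((2:ℝ) / 3) := by
  rw [Finset.sum_range_succ']
  have h1 : ∀ i : ℕ, ((max 1 (i + 1) : ℕ) : ℝ) ^ (-(1:ℝ) / 3) = ((i + 1 : ℕ) : ℝ) ^ (-(1:ℝ) / 3) := fun i => by
    rw [max_eq_right (by omega)]
  simp only [h1, show ((max 1 0 : ℕ) : ℝ) ^ (-(1:ℝ) / 3) = 1 by simp]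
  linarith [sum_rpow_neg_third_le J]

/-! ## Counting medial vertices through their doubled coordinates -/

/-- Real-valued form of `#Icc a b = (b + 1 - a)⁺`. [folklore] -/
theorem card_Icc_real_le (a b : ℤ) : ((Finset.Icc a b).card : ℝ) ≤ max 0 ((b : ℝ) + 1 - a) := by
  rw [Int.card_Icc, ← Int.cast_natCast (R := ℝ), Int.toNat_eq_max]; push_cast
  rw [max_comm]

/-- At most `2w + 1` integers lie within `w` of a real number. [folklore] -/
theorem card_Icc_ceil_floor_le (x w : ℝ) (hw : 0 ≤ w) : ((Finset.Icc ⌈x - w⌉ ⌊x + w⌋).card : ℝ) ≤ 2 * w + 1 :=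
  (card_Icc_real_le _ _).trans (max_le (by linarith) (by linarith [Int.floor_le (x + w), Int.le_ceil (x - w)]))

/-- Medial vertices are counted by their doubled coordinates. [folklore] -/
theorem card_le_of_UV_mem {P : Finset (Site 2 × Fin 2)} {T : Finset (ℤ × ℤ)} (h : ∀ p ∈ P, (U p, V p) ∈ T) :
    P.card ≤ T.card :=
  Finset.card_le_card_of_injOn (fun p => (U p, V p)) (fun p hp => Finset.mem_coe.2 (h p (Finset.mem_coe.1 hp)))
    (fun _ _ _ _ hpq => eq_of_UV_eq (Prod.mk.inj hpq).1 (Prod.mk.inj hpq).2)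

/-- The integer box of doubled coordinates around a point `c` with radius `2d`. [folklore] -/
def uvBox (δ : ℝ) (c : ℂ) (d : ℝ) : Finset (ℤ × ℤ) :=
  Finset.Icc ⌈2 * c.re / δ - 2 * d⌉ ⌊2 * c.re / δ + 2 * d⌋ ×ˢ Finset.Icc ⌈2 * c.im / δ - 2 * d⌉ ⌊2 * c.im / δ + 2 * d⌋

/-- A medial vertex within `d·δ` of `c` has its doubled coordinates in the box. [folklore] -/
theorem UV_mem_uvBox {δ : ℝ} (hδ : 0 < δ) {p : Site 2 × Fin 2} {c : ℂ} {d : ℝ}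
    (h : ‖medialPoint δ (medialVertexOf p) - c‖ ≤ d * δ) : (U p, V p) ∈ uvBox δ c d := by
  have hre := (Complex.abs_re_le_norm _).trans h
  have him := (Complex.abs_im_le_norm _).trans h
  rw [Complex.sub_re, medialPoint_re, abs_le] at hre
  rw [Complex.sub_im, medialPoint_im, abs_le] at him
  simp only [uvBox, Finset.mem_product, Finset.mem_Icc, Int.ceil_le, Int.le_floor]
  refine ⟨⟨?_, ?_⟩, ?_, ?_⟩
  · rw [sub_le_iff_le_add, div_le_iff₀ hδ]; nlinarith [hre.1]
  · rw [← sub_le_iff_le_add, le_div_iff₀ hδ]; nlinarith [hre.2]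
  · rw [sub_le_iff_le_add, div_le_iff₀ hδ]; nlinarith [him.1]
  · rw [← sub_le_iff_le_add, le_div_iff₀ hδ]; nlinarith [him.2]

/-- The box has at most `(4d + 1)²` points. [folklore] -/
theorem card_uvBox_le (δ : ℝ) (c : ℂ) {d : ℝ} (hd : 0 ≤ d) : ((uvBox δ c d).card : ℝ) ≤ (4 * d + 1) ^ 2 := by
  rw [uvBox, Finset.card_product, Nat.cast_mul]
  have h1 := card_Icc_ceil_floor_le (2 * c.re / δ) (2 * d) (by linarith)
  have h2 := card_Icc_ceil_floor_le (2 * c.im / δ) (2 * d) (by linarith)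
  nlinarith [h1, h2, Nat.cast_nonneg (α := ℝ) (Finset.Icc ⌈2 * c.re / δ - 2 * d⌉ ⌊2 * c.re / δ + 2 * d⌋).card,
    Nat.cast_nonneg (α := ℝ) (Finset.Icc ⌈2 * c.im / δ - 2 * d⌉ ⌊2 * c.im / δ + 2 * d⌋).card]

/-- The doubled coordinates adjacent to the grid lines of modulus `m` inside `[Umin, Umax]`. [folklore] -/
def gridLines (m Umin Umax : ℤ) : Finset ℤ :=
  (Finset.Icc ((Umin + 1) / m) ((Umax + 1) / m)).image (fun a => m * a) ∪
    (Finset.Icc ((Umin + 1) / m) ((Umax + 1) / m)).image (fun a => m * a - 1)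

/-- A crossing coordinate in range is adjacent to a grid line in range. [folklore] -/
theorem mem_gridLines {m : ℤ} (hm : 2 ≤ m) {U Umin Umax : ℤ} (hc : U % m = 0 ∨ U % m = m - 1) (h1 : Umin ≤ U)
    (h2 : U ≤ Umax) : U ∈ gridLines m Umin Umax := by
  have hm0 : 0 < m := by omega
  have hmem : (U + 1) / m ∈ Finset.Icc ((Umin + 1) / m) ((Umax + 1) / m) :=
    Finset.mem_Icc.2 ⟨Int.ediv_le_ediv hm0 (by omega), Int.ediv_le_ediv hm0 (by omega)⟩
  have hdecomp := Int.emod_add_mul_ediv U m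
  rcases hc with h0 | h0
  · refine Finset.mem_union_left _ (Finset.mem_image.2 ⟨(U + 1) / m, hmem, ?_⟩)
    rw [ediv_add_one_eq hm0 (by omega)]; linarith
  · refine Finset.mem_union_right _ (Finset.mem_image.2 ⟨(U + 1) / m, hmem, ?_⟩)
    rw [ediv_add_one_eq_succ hm0 h0]; linear_combination hdecomp - h0

/-- There are few grid lines in a range: `#gridLines ≤ 2((Umax - Umin)/m + 2)`. [folklore] -/
theorem card_gridLines_le {m : ℤ} (hm : 0 < m) {Umin Umax : ℤ} (hle : Umin ≤ Umax) :
    ((gridLines m Umin Umax).card : ℝ) ≤ 2 * (((Umax : ℝ) - Umin) / m + 2) := by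
  have hmr : (0:ℝ) < m := by exact_mod_cast hm
  have hc : ((Finset.Icc ((Umin + 1) / m) ((Umax + 1) / m)).card : ℝ) ≤ ((Umax : ℝ) - Umin) / m + 2 := by
    refine (card_Icc_real_le _ _).trans (max_le ?_ ?_)
    · linarith [div_nonneg (by exact_mod_cast sub_nonneg.2 hle : (0:ℝ) ≤ (Umax : ℝ) - Umin) hmr.le]
    · have e1 : (((Umax + 1) / m : ℤ) : ℝ) ≤ ((Umax + 1 : ℤ) : ℝ) / m := by
        rw [le_div_iff₀ hmr]; exact_mod_cast Int.ediv_mul_le (Umax + 1) hm.ne'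
      have e2 : ((Umin + 1 : ℤ) : ℝ) / m - 1 < (((Umin + 1) / m : ℤ) : ℝ) := by
        have h' : ((Umin + 1 : ℤ) : ℝ) < ((((Umin + 1) / m : ℤ) : ℝ) + 1) * m := by
          exact_mod_cast Int.lt_ediv_add_one_mul_self (Umin + 1) hm
        rw [sub_lt_iff_lt_add, div_lt_iff₀ hmr]; linarith
      have e3 : ((Umax + 1 : ℤ) : ℝ) / m - ((Umin + 1 : ℤ) : ℝ) / m = ((Umax : ℝ) - Umin) / m := by push_cast; ring
      linarith
  have hu := (Finset.card_union_le _ _).trans (add_le_add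
    (Finset.card_image_le (s := Finset.Icc ((Umin + 1) / m) ((Umax + 1) / m)) (f := fun a => m * a))
    (Finset.card_image_le (s := Finset.Icc ((Umin + 1) / m) ((Umax + 1) / m)) (f := fun a => m * a - 1)))
  have hu' : ((gridLines m Umin Umax).card : ℝ) ≤ ((Finset.Icc ((Umin + 1) / m) ((Umax + 1) / m)).card : ℝ) +
      ((Finset.Icc ((Umin + 1) / m) ((Umax + 1) / m)).card : ℝ) := by rw [gridLines]; exact_mod_cast hu
  linarith

/-! ## The grid of cells and the finite set `S′` -/

/-- The centre of the cell `(a, b)` of the grid of side `L`. [folklore] -/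
def center (L : ℝ) (a b : ℤ) : ℂ := ((L * ((a : ℝ) + 1 / 2) : ℝ) : ℂ) + ((L * ((b : ℝ) + 1 / 2) : ℝ) : ℂ) * I

/-- A medial vertex is within `L = Nδ` of the centre of its cell (cells of doubled modulus `2N`). [folklore] -/
theorem norm_medialPoint_sub_center {δ : ℝ} (hδ : 0 < δ) {N : ℕ} (hN : 0 < N) (p : Site 2 × Fin 2) :
    ‖medialPoint δ (medialVertexOf p) - center (N * δ) (U p / (2 * N)) (V p / (2 * N))‖ ≤ N * δ := by
  have hm : (0 : ℤ) < 2 * N := by positivity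
  have key : ∀ W : ℤ, |δ / 2 * (W : ℝ) - N * δ * (((W / (2 * N) : ℤ) : ℝ) + 1 / 2)| ≤ N * δ / 2 := fun W => by
    have h1r : ((W % (2 * N) : ℤ) : ℝ) + 2 * N * ((W / (2 * N) : ℤ) : ℝ) = W := by
      have := congrArg (Int.cast (R := ℝ)) (Int.emod_add_mul_ediv W (2 * N)); push_cast at this; linarith
    have h0r : (0:ℝ) ≤ ((W % (2 * N) : ℤ) : ℝ) := by exact_mod_cast Int.emod_nonneg W hm.ne'
    have h2r : ((W % (2 * N) : ℤ) : ℝ) < 2 * N := by exact_mod_cast Int.emod_lt_of_pos W hm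
    rw [show δ / 2 * (W : ℝ) - N * δ * (((W / (2 * N) : ℤ) : ℝ) + 1 / 2) = δ / 2 * (((W % (2 * N) : ℤ) : ℝ) - N) by
      rw [← h1r]; ring, abs_mul, abs_of_pos (by positivity : (0:ℝ) < δ / 2)]
    have hb : |((W % (2 * N) : ℤ) : ℝ) - N| ≤ N := abs_le.2 ⟨by linarith, by linarith⟩
    nlinarith [mul_le_mul_of_nonneg_left hb (by positivity : (0:ℝ) ≤ δ / 2)]
  refine (Complex.norm_le_abs_re_add_abs_im _).trans ?_
  rw [Complex.sub_re, Complex.sub_im, medialPoint_re, medialPoint_im]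
  have k1 := key (U p)
  have k2 := key (V p)
  simp only [center, Complex.add_re, Complex.ofReal_re, Complex.mul_re, Complex.I_re, Complex.ofReal_im,
    Complex.I_im, Complex.add_im, Complex.mul_im] at k1 k2 ⊢
  norm_num at k1 k2 ⊢
  linarith

/-- Normal coordinate of the medial point of `p` at mesh `δ`. [folklore] -/
def τc (w₀ n : ℂ) (δ : ℝ) (p : Site 2 × Fin 2) : ℝ := nco w₀ n (medialPoint δ (medialVertexOf p))

/-- Tangential coordinate of the medial point of `p` at mesh `δ`. [folklore] -/
def σc (w₀ n : ℂ) (δ : ℝ) (p : Site 2 × Fin 2) : ℝ := tco w₀ n (medialPoint δ (medialVertexOf p))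

/-- Normal coordinate of the centre of the grid cell of `p` (cells of side `Nδ`, doubled modulus `2N`). [folklore] -/
def cellDepth (w₀ n : ℂ) (δ : ℝ) (N : ℕ) (p : Site 2 × Fin 2) : ℝ := nco w₀ n (center (N * δ) (U p / (2 * N)) (V p / (2 * N)))

open Classical in
/-- **The finite set `S′` of the contour argument**: interior medial vertices with tangential coordinate `|s| < r`, positive normal coordinate, lying in a LOW grid cell (centre depth `< 3h/2`) — the region between the wall window and the axis-parallel staircase formed by the top sides of the low cells (junk `∅` if infinite, which does not happen for admissible data). [folklore] -/
def Sset (E : DiscreteDobrushin) (w₀ n : ℂ) (δ r h : ℝ) (N : ℕ) : Finset (Site 2 × Fin 2) :=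
  if hf : {p : Site 2 × Fin 2 | IsInteriorMV E p ∧ |σc w₀ n δ p| < r ∧ 0 < τc w₀ n δ p ∧
      cellDepth w₀ n δ N p < 3 * h / 2}.Finite then hf.toFinset else ∅

/-- The site of an interior medial vertex lies in the discrete domain, and so does the other endpoint. [folklore] -/
theorem mem_meshDomain_of_interior {E : DiscreteDobrushin} {p : Site 2 × Fin 2} (hp : IsInteriorMV E p) :
    p.1 ∈ meshDomain E.Ω E.δ ∧ p.1 + Pi.single p.2 1 ∈ meshDomain E.Ω E.δ := by
  have h := hp.1
  change s(p.1, p.1 + Pi.single p.2 1) ∈ _ at h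
  rw [SimpleGraph.mem_edgeSet] at h
  exact (discreteDomainGraph_adj_iff.1 h).2

/-- For admissible data the interior medial vertices are finitely many. [folklore] -/
theorem finite_interior {E : DiscreteDobrushin} (hE : E.IsZdAdmissible) : {p : Site 2 × Fin 2 | IsInteriorMV E p}.Finite := by
  refine ((meshDomain_finite hE.isBounded hE.delta_pos).prod (Set.finite_univ (α := Fin 2))).subset ?_
  rintro ⟨x, i⟩ hp
  exact ⟨(mem_meshDomain_of_interior hp).1, Set.mem_univ _⟩

/-- Membership in `S′`. [folklore] -/
theorem mem_Sset {E : DiscreteDobrushin} (hE : E.IsZdAdmissible) {w₀ n : ℂ} {δ r h : ℝ} {N : ℕ} {p : Site 2 × Fin 2} :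
    p ∈ Sset E w₀ n δ r h N ↔ IsInteriorMV E p ∧ |σc w₀ n δ p| < r ∧ 0 < τc w₀ n δ p ∧ cellDepth w₀ n δ N p < 3 * h / 2 := by
  have hf : {p : Site 2 × Fin 2 | IsInteriorMV E p ∧ |σc w₀ n δ p| < r ∧ 0 < τc w₀ n δ p ∧
      cellDepth w₀ n δ N p < 3 * h / 2}.Finite := (finite_interior hE).subset fun p hp => hp.1
  rw [Sset, dif_pos hf, Set.Finite.mem_toFinset]; rfl

/-- Normal coordinate vs depth of the cell centre: within `Nδ`. [folklore] -/
theorem abs_τc_sub_cellDepth_le {w₀ n : ℂ} (hn : ‖n‖ = 1) {δ : ℝ} (hδ : 0 < δ) {N : ℕ} (hN0 : 0 < N) (p : Site 2 × Fin 2) :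
    |τc w₀ n δ p - cellDepth w₀ n δ N p| ≤ N * δ :=
  (abs_nco_sub_le hn _ _ _).trans (norm_medialPoint_sub_center hδ hN0 p)

/-- The medial point of the twin is within `δ` (they share a corner site). [folklore] -/
theorem norm_twin_sub_le {δ : ℝ} (hδ : 0 ≤ δ) (p : Site 2 × Fin 2) (k : Fin 4) :
    ‖medialPoint δ (medialVertexOf (twin p.1 p.2 k)) - medialPoint δ (medialVertexOf p)‖ ≤ δ := by
  have h1 := norm_corner_sub_medialPoint hδ p k
  have h2 := norm_corner_sub_medialPoint hδ (twin p.1 p.2 k) (k + 2)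
  rw [Literature.Barriers.CriticalPhenomena.HalfCRGreen.medialCornersAt_twin] at h2
  have := norm_sub_le_norm_sub_add_norm_sub (medialPoint δ (medialVertexOf (twin p.1 p.2 k)))
    (meshPoint δ (medialCornersAt p.1 p.2 k).1) (medialPoint δ (medialVertexOf p))
  rw [norm_sub_rev] at h2
  linarith

/-- Wall coordinates of the twin differ by at most `δ`. [folklore] -/
theorem abs_twin_coords_sub_le {w₀ n : ℂ} (hn : ‖n‖ = 1) {δ : ℝ} (hδ : 0 ≤ δ) (p : Site 2 × Fin 2) (k : Fin 4) :
    |τc w₀ n δ (twin p.1 p.2 k) - τc w₀ n δ p| ≤ δ ∧ |σc w₀ n δ (twin p.1 p.2 k) - σc w₀ n δ p| ≤ δ :=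
  ⟨(abs_nco_sub_le hn _ _ _).trans (norm_twin_sub_le hδ p k), (abs_tco_sub_le hn _ _ _).trans (norm_twin_sub_le hδ p k)⟩

/-- Medial points of the region `|s| < r`, `0 < t < 2h` (`h ≤ r/4`) are within `3r/2` of the wall point. [folklore] -/
theorem norm_medialPoint_sub_lt {w₀ n : ℂ} (hn : ‖n‖ = 1) {δ r h : ℝ} (hhr : h ≤ r / 4) {p : Site 2 × Fin 2}
    (hs : |σc w₀ n δ p| < r) (ht0 : 0 < τc w₀ n δ p) (ht : τc w₀ n δ p < 2 * h) :
    ‖medialPoint δ (medialVertexOf p) - w₀‖ < 3 * r / 2 := by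
  have := norm_sub_le_nco_tco hn w₀ (medialPoint δ (medialVertexOf p))
  have ht0' : 0 < nco w₀ n (medialPoint δ (medialVertexOf p)) := ht0
  have ht' : nco w₀ n (medialPoint δ (medialVertexOf p)) < 2 * h := ht
  have hs' : |tco w₀ n (medialPoint δ (medialVertexOf p))| < r := hs
  rw [abs_of_pos ht0'] at this
  linarith

end S6

/-- **Registered one-line form `stub_flux_harmonicSum`** (sub-goal of stmt-CriticalPhenomena-10814 carried by this helper file): the harmonic sum of the transversal estimate, `Σ_{i<m} (i+1)^{-1/3} ≤ (3/2) m^{2/3}`. [folklore] -/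
theorem stub_flux_harmonicSum : ∀ m : ℕ, ∑ i ∈ Finset.range m, ((i + 1 : ℕ) : ℝ) ^ (-(1:ℝ) / 3) ≤ 3 / 2 * (m : ℝ) ^ ((2:ℝ) / 3) :=
  S6.sum_rpow_neg_third_le

end Summit.CriticalPhenomena.CardyFormulaZ2.Theorems.ParafermionFamiliesToSLESix.StripAnchored

end
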